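import Literature.NumberTheory.EllipticCurves.DivisionTowerH1OrderTwoCriterion
import Literature.NumberTheory.EllipticCurves.DivisionTowerH1AnnihilatorOfHomothetyProofs
import HarnessLib

/-!
# Route `GenusKolyvaginAtTwo`, residual `OffCutResidualAtTwoR` (stmt-BirchSwinnertonDyer-31767), LINE 27 «socle_selection» STUB S2, conjunct (HL) —
# THE VISIBILITY CRITERION: the non-zero class of `ker (H¹(G, M) → H¹(N, M))` does NOT die on `⟨c⟩` for an element `c` of «`diag(1, −1)` type»
# (abstract `GL₂(ℤ/2^k)` criterion, companion of the tree's `Rubin1987.eq_zero_or_eq_zero_or_eq_of_mem_subgroupResKer`)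

Seat `bsd-line-gk2-p4` g30 (cell `bsd-f1-sign2`), WIDTH-5 attach on route `GenusKolyvaginAtTwo` rev 59.  `--supports stmt-BirchSwinnertonDyer-31767 --as
helper`.  THEOREMS ONLY (no definition, no named fact, no `sorry`); standard axioms.  **BSD is NOT proved by this file; `OffCutResidualAtTwoR` is NOT
proved; LINE 27's stub S2 is NOT closed by this file alone.**

WHY.  LINE 27's stub S2 (HL) asks that no non-zero multiple of the level-raised Heegner class be PHANTOM (vanish on `Γ_(K(E[2^L]))`); the card's
mechanism is «Lawson–Wuthrich visibility at a `Δ > 0` complex conjugation»: the non-zero phantom class `ξ ∈ H¹(Gal(ℚ(E[2^k])/ℚ), E[2^k]) ≅ ℤ/2`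
restricts NON-TRIVIALLY to the decomposition group `{1, c}` at `∞` when `c` acts on `E[2^k]` as `diag(1, −1)` — whereas a real-trivial Selmer class
restricts trivially.  This file proves the ABSTRACT form of that visibility in the vocabulary of the tree's order-two criterion
(`DivisionTowerH1OrderTwoCriterion{Stabilizer}`, Lawson–Wuthrich 2016 at the even prime): under the `GL₂(ℤ/2^k)` hypotheses of
`Rubin1987.eq_zero_or_eq_zero_or_eq_of_mem_subgroupResKer` (`N ⊴ G` open acting trivially on `M`, `z` central mod `N` acting as `3`, transvections
`t, t'` with the halving property acting on `V = M[2] = {0, E₁, E₂, E₁ + E₂}` as the standard ones, `s t s⁻¹ ≡ t'`, a diagonal family, `G_V ⊆ ⟨t², t'², d⟩N`)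
and for an element `c ∈ G_V` with `t c t⁻¹ ≡ c (t²)^m`, `t' c t'⁻¹ ≡ c (t'²)^m'` (mod `N`) for ODD `m, m'` and `E₁ + E₂ ∉ (c − 1)M` — the relations
satisfied by `ρ(c) = diag(1, −1)` — EVERY crossed homomorphism `f` vanishing on `N` whose class is non-zero has `f(c) ∉ (c − 1)M`:
* §1 algebra of `M[2]`-valued crossed homomorphisms on the stabiliser `G_V` (additivity, conjugation-equivariance, odd powers; the tree's versions
  are `private`);
* §2 `apply_eq_add_of_conj_rel_odd` — a NORMALISED (`M[2]`-valued) `f` with `f(t²) = E₁`, `f(t'²) = E₂` has **`f(c) = E₁ + E₂`**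
  (`t • f(c) = f(c) + E₁` and `t' • f(c) = f(c) + E₂` leave only `E₁ + E₂` among `{0, E₁, E₂, E₁ + E₂}`);
* §3 ★ `apply_ne_smul_sub_of_inflClass_ne_zero` — for ANY `f ∈ Z¹` vanishing on `N` with `[f] ≠ 0`: **`f(c) ≠ c • y − y` for all `y`**
  (normalise by Sah + halving, read the bits `f(t²) ∈ {0, E₁}`, `f(t'²) ∈ {0, E₂}` — a zero bit makes the class vanish by the tree's Step 5,
  the second one through the swap symmetry `t ↔ t'`, `E₁ ↔ E₂`, `s ↦ s⁻¹` —, then §2), and the class form ★ `not_mem_subgroupResKer_zpowers`: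
  **a non-zero `κ ∈ ker (H¹(G, M) → H¹(N, M))` is NOT in `ker (H¹(G, M) → H¹(⟨c⟩, M))`**.
The elliptic-curve discharge (framed surjective `ρ̄_{E,2^k}`, `c` with `E[2^k] = E[2^k]^{c=1} + E[2^k]^{c=−1}` of type `(1, 1)`, e.g. a complex
conjugation when `Δ > 0`) is the sequel file.  BSD is NOT proved by any of this.

References: [LawsonWuthrich2016] T. Lawson, C. Wuthrich, *Vanishing of some Galois cohomology groups for elliptic curves* (2016), Lemma 3, §5,
§7.1; [Sah1968] Prop. 2.7 (b); [SerreGaloisCohomology1997] I.§2.2, I.§5.8; [GrossLMS1991] §9.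
-/

set_option autoImplicit false
set_option linter.dupNamespace false -- `Summit.<P>.<Sub>` repeats `BirchSwinnertonDyer` (D-0017)

noncomputable section

open scoped Classical

namespace Summit.BirchSwinnertonDyer.BirchSwinnertonDyer.Theorems.GenusExact.PlusDescent.SocleSelection.RealVisible

open Literature.NumberTheory.EllipticCurves Literature.NumberTheory.GaloisRepresentations
open Literature.NumberTheory.EllipticCurves.Rubin1987

universe u

/-! ## §1 `M[2]`-valued crossed homomorphisms on the stabiliser `G_V` -/

section Algebra

variable {G : Type u} [Group G] {M : Type u} [AddCommGroup M] [DistribMulAction G M]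
variable {N : Subgroup G}

/-- `f(1) = 0` for a crossed homomorphism. [folklore] -/
theorem apply_one (f : cocyclesVanishingOn M N) : f.1 1 = 0 := by
  have h := cocyclesVanishingOn.cocycle f (1 : G) 1
  rw [mul_one, one_smul, left_eq_add] at h
  exact h

/-- On the stabiliser `G_V` of `V = M[2]` an `M[2]`-valued crossed homomorphism is ADDITIVE: `f(a b) = f(a) + f(b)` for `a ∈ G_V`. [folklore] -/
theorem apply_mul_of_mem_fixingSubgroup (f : cocyclesVanishingOn M N) (hfV : ∀ g, (2 : ℤ) • f.1 g = 0)
    {a : G} (ha : a ∈ fixingSubgroup G {v : M | (2 : ℤ) • v = 0}) (b : G) :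
    f.1 (a * b) = f.1 a + f.1 b := by
  rw [cocyclesVanishingOn.cocycle f, (mem_fixingSubgroup_iff G).1 ha _ (hfV b)]

/-- … and conjugation-EQUIVARIANT: `f(g a g⁻¹) = g • f(a)` for `a ∈ G_V`. [folklore] -/
theorem apply_conj_of_mem_fixingSubgroup (f : cocyclesVanishingOn M N) (hfV : ∀ g, (2 : ℤ) • f.1 g = 0)
    {a : G} (ha : a ∈ fixingSubgroup G {v : M | (2 : ℤ) • v = 0}) (g : G) :
    f.1 (g * a * g⁻¹) = g • f.1 a := by
  have h1 : f.1 (g * a * g⁻¹) = f.1 g + g • f.1 a + g • f.1 g⁻¹ := by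
    rw [cocyclesVanishingOn.cocycle f, cocyclesVanishingOn.cocycle f, mul_smul,
      (mem_fixingSubgroup_iff G).1 ha _ (hfV g⁻¹), add_assoc]
  have h2 : f.1 g + g • f.1 g⁻¹ = 0 := by
    rw [← cocyclesVanishingOn.cocycle f, mul_inv_cancel, apply_one]
  rw [h1, add_comm (f.1 g), add_assoc, h2, add_zero]

/-- Powers on the stabiliser: `f(x^m) = m • f(x)` for `x ∈ G_V` and `m : ℕ`. [folklore] -/
theorem apply_pow_of_mem_fixingSubgroup (f : cocyclesVanishingOn M N) (hfV : ∀ g, (2 : ℤ) • f.1 g = 0)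
    {x : G} (hx : x ∈ fixingSubgroup G {v : M | (2 : ℤ) • v = 0}) (m : ℕ) :
    f.1 (x ^ m) = (m : ℤ) • f.1 x := by
  induction m with
  | zero => rw [pow_zero, apply_one, Nat.cast_zero, zero_smul]
  | succ m ih =>
    rw [pow_succ', apply_mul_of_mem_fixingSubgroup f hfV hx, ih, Nat.cast_succ, add_smul, one_smul, add_comm]

/-- Integer powers on the stabiliser: `f(x^m) = m • f(x)` for `x ∈ G_V` and `m : ℤ`. [folklore] -/
theorem apply_zpow_of_mem_fixingSubgroup (f : cocyclesVanishingOn M N) (hfV : ∀ g, (2 : ℤ) • f.1 g = 0)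
    {x : G} (hx : x ∈ fixingSubgroup G {v : M | (2 : ℤ) • v = 0}) (m : ℤ) :
    f.1 (x ^ m) = m • f.1 x := by
  rcases Int.eq_nat_or_neg m with ⟨n, rfl | rfl⟩
  · rw [zpow_natCast, apply_pow_of_mem_fixingSubgroup f hfV hx n]
  · rw [zpow_neg, zpow_natCast, neg_smul]
    have hxn : x ^ n ∈ fixingSubgroup G {v : M | (2 : ℤ) • v = 0} := Subgroup.pow_mem _ hx n
    have h : f.1 ((x ^ n)⁻¹ * x ^ n) = f.1 (x ^ n)⁻¹ + f.1 (x ^ n) :=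
      apply_mul_of_mem_fixingSubgroup f hfV ((fixingSubgroup G _).inv_mem hxn) (x ^ n)
    rw [inv_mul_cancel, apply_one] at h
    rw [eq_neg_of_add_eq_zero_left h.symm, apply_pow_of_mem_fixingSubgroup f hfV hx n]

/-- ODD powers on the stabiliser: `f(x^m) = f(x)` for `x ∈ G_V`, `m` odd, since `2 • f(x) = 0`. [folklore] -/
theorem apply_zpow_of_odd (f : cocyclesVanishingOn M N) (hfV : ∀ g, (2 : ℤ) • f.1 g = 0)
    {x : G} (hx : x ∈ fixingSubgroup G {v : M | (2 : ℤ) • v = 0}) {m : ℤ} (hm : Odd m) :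
    f.1 (x ^ m) = f.1 x := by
  obtain ⟨k, rfl⟩ := hm
  rw [apply_zpow_of_mem_fixingSubgroup f hfV hx, add_smul, one_smul, mul_comm, mul_smul, hfV x, smul_zero, zero_add]

/-! ## §2 The value at `c`: `f(c) = E₁ + E₂` for a normalised `f` with bits `f(t²) = E₁`, `f(t'²) = E₂` -/

/-- **`f(c) = E₁ + E₂`.**  `f` an `M[2]`-valued crossed homomorphism vanishing on `N` with `f(t²) = E₁` and `f(t'²) = E₂`; `c ∈ G_V` with
`t c t⁻¹ = c (t²)^m n`, `t' c t'⁻¹ = c (t'²)^m' n'` for ODD `m, m'` and `n, n' ∈ N` (the relations of `diag(1, −1)` against the two transvections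
of `GL₂(ℤ/2^k)`).  Equivariance gives `t • f(c) = f(c) + E₁` and `t' • f(c) = f(c) + E₂`; of the four elements of `V` only `E₁ + E₂` passes.
[cite: LawsonWuthrich2016, Lemma 3, §7.1] -/
theorem apply_eq_add_of_conj_rel_odd (f : cocyclesVanishingOn M N) (hfV : ∀ g, (2 : ℤ) • f.1 g = 0)
    {E₁ E₂ : M} (h2E₁ : (2 : ℤ) • E₁ = 0) (h2E₂ : (2 : ℤ) • E₂ = 0) (hE₁ : E₁ ≠ 0) (hE₂ : E₂ ≠ 0)
    (hV : ∀ v : M, (2 : ℤ) • v = 0 → v = 0 ∨ v = E₁ ∨ v = E₂ ∨ v = E₁ + E₂)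
    {t t' : G} (ht₁ : t • E₁ = E₁) (ht'₂ : t' • E₂ = E₂)
    (htt : t * t ∈ fixingSubgroup G {v : M | (2 : ℤ) • v = 0}) (ht't' : t' * t' ∈ fixingSubgroup G {v : M | (2 : ℤ) • v = 0})
    (hu : f.1 (t * t) = E₁) (hl : f.1 (t' * t') = E₂)
    {c : G} (hcV : c ∈ fixingSubgroup G {v : M | (2 : ℤ) • v = 0})
    (hct : ∃ m : ℤ, Odd m ∧ ∃ n ∈ N, t * c * t⁻¹ = c * (t * t) ^ m * n)
    (hct' : ∃ m : ℤ, Odd m ∧ ∃ n ∈ N, t' * c * t'⁻¹ = c * (t' * t') ^ m * n) :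
    f.1 c = E₁ + E₂ := by
  have h11 : E₁ + E₁ = 0 := by rw [← two_zsmul, h2E₁]
  have h22 : E₂ + E₂ = 0 := by rw [← two_zsmul, h2E₂]
  have h1 : t • f.1 c = f.1 c + E₁ := by
    obtain ⟨m, hm, n, hn, hrel⟩ := hct
    rw [← apply_conj_of_mem_fixingSubgroup f hfV hcV t, hrel, cocyclesVanishingOn.apply_mul_of_mem f _ hn,
      apply_mul_of_mem_fixingSubgroup f hfV hcV, apply_zpow_of_odd f hfV htt hm, hu]
  have h2 : t' • f.1 c = f.1 c + E₂ := by
    obtain ⟨m, hm, n, hn, hrel⟩ := hct'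
    rw [← apply_conj_of_mem_fixingSubgroup f hfV hcV t', hrel, cocyclesVanishingOn.apply_mul_of_mem f _ hn,
      apply_mul_of_mem_fixingSubgroup f hfV hcV, apply_zpow_of_odd f hfV ht't' hm, hl]
  rcases hV _ (hfV c) with h | h | h | h
  · exfalso; apply hE₁
    rw [h, smul_zero, zero_add] at h1
    exact h1.symm
  · exfalso; apply hE₁
    rw [h, ht₁] at h1
    -- `h1 : E₁ = E₁ + E₁`
    have : E₁ + E₁ = E₁ := h1.symm
    exact add_eq_left.1 this
  · exfalso; apply hE₂
    rw [h, ht'₂] at h2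
    have : E₂ + E₂ = E₂ := h2.symm
    exact add_eq_left.1 this
  · exact h

end Algebra

/-! ## §3 ★ The visibility criterion -/

section Main

variable {G : Type u} [Group G] [TopologicalSpace G] [IsTopologicalGroup G]
variable {M : Type u} [AddCommGroup M] [DistribMulAction G M] [TopologicalSpace M] [DiscreteTopology M]
variable {N : Subgroup G} [N.Normal]

omit [N.Normal] in
/-- The inflated class is unchanged by a coboundary shift. [folklore] -/
theorem inflClass_eq_of_shift (hN : IsOpen (N : Set G)) (f f' : cocyclesVanishingOn M N) (w : M)
    (h : ∀ g, f'.1 g = f.1 g - (g • w - w)) : inflClass M N hN f' = inflClass M N hN f := by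
  rw [← sub_eq_zero, ← map_sub, inflClass_apply, oneCocycleClass_eq_zero_iff]
  refine ⟨-w, fun g ↦ ?_⟩
  rw [discreteTopRep_ρ_apply, toContOneCocycle_apply]
  change f'.1 g - f.1 g = g • (-w) - (-w)
  rw [h g, smul_neg]
  abel

/-- **A normalised phantom cocycle with bit `f(t²) = 0` has class `0`** (the tree's Step 5, packaged): vanishing on `G_V`
(`apply_eq_zero_of_mem_fixingSubgroup_of_apply_mul_self_eq_zero`) then coboundary (`exists_eq_smul_sub_of_apply_fixingSubgroup_eq_zero`).
[cite: LawsonWuthrich2016, Lemma 3, §5, §7.1] -/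
theorem inflClass_eq_zero_of_apply_mul_self_eq_zero (hN : IsOpen (N : Set G)) (hNM : ∀ n ∈ N, ∀ x : M, n • x = x)
    (f : cocyclesVanishingOn M N) (hfV : ∀ g, (2 : ℤ) • f.1 g = 0)
    {E₁ E₂ : M} (h2E₁ : (2 : ℤ) • E₁ = 0) (h2E₂ : (2 : ℤ) • E₂ = 0) (hE₁ : E₁ ≠ 0) (hE₂ : E₂ ≠ 0)
    (hE₁₂ : E₁ ≠ E₂) (hV : ∀ v : M, (2 : ℤ) • v = 0 → v = 0 ∨ v = E₁ ∨ v = E₂ ∨ v = E₁ + E₂)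
    {t t' s : G} (ht₁ : t • E₁ = E₁) (ht₂ : t • E₂ = E₁ + E₂) (ht'₁ : t' • E₁ = E₁ + E₂) (ht'₂ : t' • E₂ = E₂)
    (hst : ∃ n ∈ N, s * t * s⁻¹ = t' * n)
    {ι : Type*} (d : ι → G) (hdV : ∀ i, d i ∈ fixingSubgroup G {v : M | (2 : ℤ) • v = 0})
    (hdt : ∀ i, ∃ (m : ℤ), ∃ n ∈ N, t * d i * t⁻¹ = d i * (t * t) ^ m * n)
    (hdt' : ∀ i, ∃ (m : ℤ), ∃ n ∈ N, t' * d i * t'⁻¹ = d i * (t' * t') ^ m * n)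
    (hgen : ∀ g ∈ fixingSubgroup G {v : M | (2 : ℤ) • v = 0},
      ∃ w ∈ Subgroup.closure ({t * t, t' * t'} ∪ Set.range d), ∃ n ∈ N, g = w * n)
    (hu : f.1 (t * t) = 0) : inflClass M N hN f = 0 := by
  have hvan := apply_eq_zero_of_mem_fixingSubgroup_of_apply_mul_self_eq_zero f hfV h2E₁ h2E₂ hE₁ hE₂ hV ht₁ ht₂ ht'₁ ht'₂ hst d hdV
    hdt hdt' hgen hu
  obtain ⟨v, -, hv⟩ := exists_eq_smul_sub_of_apply_fixingSubgroup_eq_zero hNM f hfV h2E₁ h2E₂ hE₁ hE₂ hE₁₂ hV ht₁ ht₂ ht'₁ ht'₂ hvan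
  rw [inflClass_apply, oneCocycleClass_eq_zero_iff]
  exact ⟨v, fun g ↦ by rw [discreteTopRep_ρ_apply, toContOneCocycle_apply]; exact hv g⟩

/-- **The `t ↔ t'` symmetric form**: a normalised phantom cocycle with bit `f(t'²) = 0` has class `0` (the previous theorem with `E₁ ↔ E₂`,
`t ↔ t'`, `s ↦ s⁻¹`; the generating set `{t², t'²} ∪ d` is symmetric). [cite: LawsonWuthrich2016, Lemma 3, §5, §7.1] -/
theorem inflClass_eq_zero_of_apply_mul_self_eq_zero' (hN : IsOpen (N : Set G)) (hNM : ∀ n ∈ N, ∀ x : M, n • x = x)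
    (f : cocyclesVanishingOn M N) (hfV : ∀ g, (2 : ℤ) • f.1 g = 0)
    {E₁ E₂ : M} (h2E₁ : (2 : ℤ) • E₁ = 0) (h2E₂ : (2 : ℤ) • E₂ = 0) (hE₁ : E₁ ≠ 0) (hE₂ : E₂ ≠ 0)
    (hE₁₂ : E₁ ≠ E₂) (hV : ∀ v : M, (2 : ℤ) • v = 0 → v = 0 ∨ v = E₁ ∨ v = E₂ ∨ v = E₁ + E₂)
    {t t' s : G} (ht₁ : t • E₁ = E₁) (ht₂ : t • E₂ = E₁ + E₂) (ht'₁ : t' • E₁ = E₁ + E₂) (ht'₂ : t' • E₂ = E₂)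
    (hst : ∃ n ∈ N, s * t * s⁻¹ = t' * n)
    {ι : Type*} (d : ι → G) (hdV : ∀ i, d i ∈ fixingSubgroup G {v : M | (2 : ℤ) • v = 0})
    (hdt : ∀ i, ∃ (m : ℤ), ∃ n ∈ N, t * d i * t⁻¹ = d i * (t * t) ^ m * n)
    (hdt' : ∀ i, ∃ (m : ℤ), ∃ n ∈ N, t' * d i * t'⁻¹ = d i * (t' * t') ^ m * n)
    (hgen : ∀ g ∈ fixingSubgroup G {v : M | (2 : ℤ) • v = 0},
      ∃ w ∈ Subgroup.closure ({t * t, t' * t'} ∪ Set.range d), ∃ n ∈ N, g = w * n)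
    (hl : f.1 (t' * t') = 0) : inflClass M N hN f = 0 := by
  -- the swapped data
  have hV' : ∀ v : M, (2 : ℤ) • v = 0 → v = 0 ∨ v = E₂ ∨ v = E₁ ∨ v = E₂ + E₁ := fun v hv ↦ by
    rcases hV v hv with h | h | h | h
    · exact Or.inl h
    · exact Or.inr (Or.inr (Or.inl h))
    · exact Or.inr (Or.inl h)
    · exact Or.inr (Or.inr (Or.inr (h.trans (add_comm _ _))))
  have hst' : ∃ n ∈ N, s⁻¹ * t' * s⁻¹⁻¹ = t * n := by
    obtain ⟨n, hn, hs⟩ := hst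
    refine ⟨s⁻¹ * n⁻¹ * s, ?_, ?_⟩
    · have h := Subgroup.Normal.conj_mem inferInstance n⁻¹ (N.inv_mem hn) s⁻¹
      rwa [inv_inv] at h
    · rw [inv_inv]
      have : t' = s * t * s⁻¹ * n⁻¹ := by rw [hs, mul_inv_cancel_right]
      rw [this]; group
  have hgen' : ∀ g ∈ fixingSubgroup G {v : M | (2 : ℤ) • v = 0},
      ∃ w ∈ Subgroup.closure ({t' * t', t * t} ∪ Set.range d), ∃ n ∈ N, g = w * n := by
    intro g hg
    have hset : ({t' * t', t * t} ∪ Set.range d : Set G) = {t * t, t' * t'} ∪ Set.range d := by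
      rw [Set.pair_comm]
    rw [hset]
    exact hgen g hg
  exact inflClass_eq_zero_of_apply_mul_self_eq_zero hN hNM f hfV h2E₂ h2E₁ hE₂ hE₁ (Ne.symm hE₁₂) hV' ht'₂ (by rw [ht'₁, add_comm])
    (by rw [ht₂, add_comm]) ht₁ hst' d hdV hdt' hdt hgen' hl

/-- ★ **THE VISIBILITY CRITERION (cocycle form).**  Under the `GL₂(ℤ/2^k)` hypotheses of the tree's order-two criterion
(`Rubin1987.eq_zero_or_eq_zero_or_eq_of_mem_subgroupResKer`) and for `c ∈ G_V` with `t c t⁻¹ ≡ c (t²)^m`, `t' c t'⁻¹ ≡ c (t'²)^m'` (mod `N`) for ODD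
`m, m'` and `E₁ + E₂ ∉ (c − 1)M` (the relations of `diag(1, −1)`): **every crossed homomorphism `f` vanishing on `N` with NON-ZERO class has
`f(c) ≠ c • y − y` for all `y ∈ M`** — the class of `f` does not die on `{1, c}`.  Proof: normalise `f` to an `M[2]`-valued `f' = f − ∂w` (Sah with
the homothety `3`, halving); the bits `f'(t²) ∈ {0, E₁}`, `f'(t'²) ∈ {0, E₂}` are both non-zero since a zero bit kills the class; then `f'(c) = E₁ + E₂`
(§2) and `f(c) = E₁ + E₂ + (c • w − w)`.  [cite: LawsonWuthrich2016, Lemma 3, §7.1] [cite: Sah1968, Prop. 2.7 (b)] [cite: GrossLMS1991, §9] -/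
theorem apply_ne_smul_sub_of_inflClass_ne_zero (hN : IsOpen (N : Set G)) (hNM : ∀ n ∈ N, ∀ x : M, n • x = x)
    {z : G} (hzc : ∀ g : G, ∃ n ∈ N, z * g = g * z * n) (hz : ∀ x : M, z • x = (3 : ℤ) • x)
    {E₁ E₂ : M} (h2E₁ : (2 : ℤ) • E₁ = 0) (h2E₂ : (2 : ℤ) • E₂ = 0) (hE₁ : E₁ ≠ 0) (hE₂ : E₂ ≠ 0)
    (hE₁₂ : E₁ ≠ E₂) (hV : ∀ v : M, (2 : ℤ) • v = 0 → v = 0 ∨ v = E₁ ∨ v = E₂ ∨ v = E₁ + E₂)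
    {t t' s : G}
    (hhalf : ∀ x : M, (∃ y : M, t • x - x = (2 : ℤ) • y) → (∃ y : M, t' • x - x = (2 : ℤ) • y) → ∃ w : M, x = (2 : ℤ) • w)
    (ht₁ : t • E₁ = E₁) (ht₂ : t • E₂ = E₁ + E₂) (ht'₁ : t' • E₁ = E₁ + E₂) (ht'₂ : t' • E₂ = E₂)
    (hst : ∃ n ∈ N, s * t * s⁻¹ = t' * n)
    {ι : Type*} (d : ι → G) (hdV : ∀ i, d i ∈ fixingSubgroup G {v : M | (2 : ℤ) • v = 0})
    (hdt : ∀ i, ∃ (m : ℤ), ∃ n ∈ N, t * d i * t⁻¹ = d i * (t * t) ^ m * n)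
    (hdt' : ∀ i, ∃ (m : ℤ), ∃ n ∈ N, t' * d i * t'⁻¹ = d i * (t' * t') ^ m * n)
    (hgen : ∀ g ∈ fixingSubgroup G {v : M | (2 : ℤ) • v = 0},
      ∃ w ∈ Subgroup.closure ({t * t, t' * t'} ∪ Set.range d), ∃ n ∈ N, g = w * n)
    {c : G} (hcV : c ∈ fixingSubgroup G {v : M | (2 : ℤ) • v = 0})
    (hct : ∃ m : ℤ, Odd m ∧ ∃ n ∈ N, t * c * t⁻¹ = c * (t * t) ^ m * n)
    (hct' : ∃ m : ℤ, Odd m ∧ ∃ n ∈ N, t' * c * t'⁻¹ = c * (t' * t') ^ m * n)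
    (hcM : ∀ y : M, c • y - y ≠ E₁ + E₂)
    (f : cocyclesVanishingOn M N) (hf : inflClass M N hN f ≠ 0) (y : M) : f.1 c ≠ c • y - y := by
  -- normalise
  obtain ⟨w, f', hf', hV'⟩ := exists_two_zsmul_apply_eq_zero hNM f hzc hz hhalf
  have hcl : inflClass M N hN f' = inflClass M N hN f := inflClass_eq_of_shift hN f f' w hf'
  have htt : t * t ∈ fixingSubgroup G {v : M | (2 : ℤ) • v = 0} := mul_self_mem_fixingSubgroup h2E₁ hV ht₁ ht₂
  have hVsw : ∀ v : M, (2 : ℤ) • v = 0 → v = 0 ∨ v = E₂ ∨ v = E₁ ∨ v = E₂ + E₁ := fun v hv ↦ by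
    rcases hV v hv with h | h | h | h
    · exact Or.inl h
    · exact Or.inr (Or.inr (Or.inl h))
    · exact Or.inr (Or.inl h)
    · exact Or.inr (Or.inr (Or.inr (h.trans (add_comm _ _))))
  have ht't' : t' * t' ∈ fixingSubgroup G {v : M | (2 : ℤ) • v = 0} :=
    mul_self_mem_fixingSubgroup h2E₂ hVsw ht'₂ (by rw [ht'₁, add_comm])
  -- the two bits are non-zero
  have hu : f'.1 (t * t) = E₁ := by
    rcases apply_mul_self_eq_zero_or_eq f' hV' h2E₁ h2E₂ hV ht₁ ht₂ with h0 | h1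
    · exfalso; apply hf
      rw [← hcl]
      exact inflClass_eq_zero_of_apply_mul_self_eq_zero hN hNM f' hV' h2E₁ h2E₂ hE₁ hE₂ hE₁₂ hV ht₁ ht₂ ht'₁ ht'₂ hst d hdV hdt hdt'
        hgen h0
    · exact h1
  have hl : f'.1 (t' * t') = E₂ := by
    rcases apply_mul_self_eq_zero_or_eq f' hV' h2E₂ h2E₁ hVsw ht'₂ (by rw [ht'₁, add_comm]) with h0 | h1
    · exfalso; apply hf
      rw [← hcl]
      exact inflClass_eq_zero_of_apply_mul_self_eq_zero' hN hNM f' hV' h2E₁ h2E₂ hE₁ hE₂ hE₁₂ hV ht₁ ht₂ ht'₁ ht'₂ hst d hdV hdt hdt'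
        hgen h0
    · exact h1
  -- the value at `c`
  have hc : f'.1 c = E₁ + E₂ :=
    apply_eq_add_of_conj_rel_odd f' hV' h2E₁ h2E₂ hE₁ hE₂ hV ht₁ ht'₂ htt ht't' hu hl hcV hct hct'
  intro hy
  apply hcM (y - w)
  have h := hf' c
  rw [hy, hc] at h
  -- `h : E₁ + E₂ = c • y - y - (c • w - w)`
  rw [h, smul_sub]
  abel

/-- ★ **THE VISIBILITY CRITERION (class form).**  Under the same hypotheses: **a NON-ZERO class `κ ∈ ker (H¹(G, M) → H¹(N, M))` is NOT in
`ker (H¹(G, M) → H¹(⟨c⟩, M))`** — the non-zero phantom class is visible on the cyclic subgroup generated by `c`.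
[cite: LawsonWuthrich2016, Lemma 3, §7.1] [cite: SerreGaloisCohomology1997, I.§5.8] -/
theorem not_mem_subgroupResKer_zpowers (hN : IsOpen (N : Set G)) (hNM : ∀ n ∈ N, ∀ x : M, n • x = x)
    {z : G} (hzc : ∀ g : G, ∃ n ∈ N, z * g = g * z * n) (hz : ∀ x : M, z • x = (3 : ℤ) • x)
    {E₁ E₂ : M} (h2E₁ : (2 : ℤ) • E₁ = 0) (h2E₂ : (2 : ℤ) • E₂ = 0) (hE₁ : E₁ ≠ 0) (hE₂ : E₂ ≠ 0)
    (hE₁₂ : E₁ ≠ E₂) (hV : ∀ v : M, (2 : ℤ) • v = 0 → v = 0 ∨ v = E₁ ∨ v = E₂ ∨ v = E₁ + E₂)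
    {t t' s : G}
    (hhalf : ∀ x : M, (∃ y : M, t • x - x = (2 : ℤ) • y) → (∃ y : M, t' • x - x = (2 : ℤ) • y) → ∃ w : M, x = (2 : ℤ) • w)
    (ht₁ : t • E₁ = E₁) (ht₂ : t • E₂ = E₁ + E₂) (ht'₁ : t' • E₁ = E₁ + E₂) (ht'₂ : t' • E₂ = E₂)
    (hst : ∃ n ∈ N, s * t * s⁻¹ = t' * n)
    {ι : Type*} (d : ι → G) (hdV : ∀ i, d i ∈ fixingSubgroup G {v : M | (2 : ℤ) • v = 0})
    (hdt : ∀ i, ∃ (m : ℤ), ∃ n ∈ N, t * d i * t⁻¹ = d i * (t * t) ^ m * n)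
    (hdt' : ∀ i, ∃ (m : ℤ), ∃ n ∈ N, t' * d i * t'⁻¹ = d i * (t' * t') ^ m * n)
    (hgen : ∀ g ∈ fixingSubgroup G {v : M | (2 : ℤ) • v = 0},
      ∃ w ∈ Subgroup.closure ({t * t, t' * t'} ∪ Set.range d), ∃ n ∈ N, g = w * n)
    {c : G} (hcV : c ∈ fixingSubgroup G {v : M | (2 : ℤ) • v = 0})
    (hct : ∃ m : ℤ, Odd m ∧ ∃ n ∈ N, t * c * t⁻¹ = c * (t * t) ^ m * n)
    (hct' : ∃ m : ℤ, Odd m ∧ ∃ n ∈ N, t' * c * t'⁻¹ = c * (t' * t') ^ m * n)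
    (hcM : ∀ y : M, c • y - y ≠ E₁ + E₂)
    {κ : discreteH1 G M} (hκ : κ ∈ subgroupResKer M N) (hκ0 : κ ≠ 0) :
    κ ∉ subgroupResKer M (Subgroup.zpowers c) := by
  have hle := resKer_le_range_inflClass (subgroupIncl N) (AddMonoidHom.id M) (fun _ _ ↦ rfl)
    Function.bijective_id N hN (fun n hn ↦ ⟨⟨n, hn⟩, rfl⟩)
  obtain ⟨f, rfl⟩ := hle hκ
  intro hmem
  rw [inflClass_apply] at hmem
  obtain ⟨a, ha⟩ := (oneCocycleClass_mem_subgroupResKer_iff (Subgroup.zpowers c) _).1 hmem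
  have hca := ha ⟨c, Subgroup.mem_zpowers c⟩
  rw [toContOneCocycle_apply] at hca
  exact apply_ne_smul_sub_of_inflClass_ne_zero hN hNM hzc hz h2E₁ h2E₂ hE₁ hE₂ hE₁₂ hV hhalf ht₁ ht₂ ht'₁ ht'₂ hst d hdV hdt hdt' hgen hcV
    hct hct' hcM f hκ0 a hca

end Main

end Summit.BirchSwinnertonDyer.BirchSwinnertonDyer.Theorems.GenusExact.PlusDescent.SocleSelection.RealVisible

end
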